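import Mathlib
import Summits.Ventures.HodgeRepro.Tier4.Target
import Summits.Ventures.HodgeRepro.Tier4.Line3.Defs
import Summits.Ventures.HodgeRepro.Tier4.Line3.LocaliserS
import Summits.Ventures.HodgeRepro.Tier4.Line3.BallCoordLemmas
import Summits.Ventures.HodgeRepro.Tier4.Line3.OrbitInvariant

/-!
# Tier4/Line3/TermTendstoZero — L3.4 `term_tendsto_zero` (the registered statement, Skeleton v0.24 L886 = v0.21 L900,
over the tree's `LocS` = the FILED `Loc` of v0.16–v0.24, `Tier4/Line3/LocaliserS.lean`; lead S12549)

Blind re-derivation cell `pub-hodge-repro`, Tier 4 «PROVE THE STEP» (README §9–§10), LINE L3, seat t4-x2 (reserve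
wall-breaker, lead S12446 / S12473).  The content is `Tier4/Line3/OrbitInvariant.lean` (`tendsto_term_zero_of_supp`); the registered statement is
stated over `X.LocS` (the tree's `Loc` of `Tier4/Line3/Localiser.lean`, p666059, is the v0.14 ONE-SIDED shape, a settled
negative for L3.4 / L3.5 — lead S12549; the planner's v0.25 folds the name):
off the main orbit the localised terms are EVENTUALLY ZERO, because `Loc.supp` (two-sided integral ball, v0.16+) puts
every line tuple with a non-zero localised coefficient in `xm + (𝔭 𝔭̄)^N L`, a fixed orbit has bounded archimedean Gram
sizes, and the product formula makes a non-zero Gram deviation in `(𝔭 𝔭̄)^N · 𝔞` unboundedly large.  Only the field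
`supp` of the localiser is used.  Nothing here asserts anything about the truth of (P); HC_CM is NOT proved by anyone in
this repository.
-/

set_option autoImplicit false

noncomputable section

namespace Summit.Ventures.HodgeRepro.Tier4.Line3

open Matrix NumberField Filter Topology

namespace T4Data

variable (X : T4Data)

/-- **L3.4 OFF THE MAIN ORBIT THE LOCALISED TERMS TEND TO ZERO** — the registered statement (Skeleton v0.24 L886 =
v0.21 L900, with `LocS` = the FILED `Loc`),
proved by EVENTUAL VANISHING: `LocS.supp` puts every line tuple with a non-zero localised coefficient in the two-sided
depth-`N` ball around `xm`; a FIXED off-main orbit has bounded archimedean Gram sizes (they are orbit invariants), while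
the product formula makes a non-zero Gram deviation in `(𝔭 𝔭̄)^N · 𝔞` unboundedly large — so from some depth on the
orbit carries no non-zero coefficient and its term is `0`.  No field of `LocS` other than `supp` is used. -/
theorem term_tendsto_zero (D : X.ThetaData) {p : IsDedekindDomain.HeightOneSpectrum (NumberField.RingOfIntegers X.E)}
    {L₀ : Submodule (NumberField.RingOfIntegers X.E) (Fin 3 → X.E)} {xm : X.Tuple} (hL : X.IsLattice L₀)
    (h02 : xm 2 = xm 0) (h13 : xm 3 = xm 1)
    (hab : X.ballCoord (xm 0) 0 * X.ballCoord (xm 1) 1 - X.ballCoord (xm 0) 1 * X.ballCoord (xm 1) 0 ≠ 0)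
    (ℓ : X.LocS D p L₀ xm) (o : X.Orbit) (ho : o ≠ X.orbitOf (X.lines xm)) :
    Tendsto (fun N => X.term D.Φ D.cf (ℓ.level N) (ℓ.loc N) o) atTop (𝓝 0) := by
  have _hL := hL
  obtain ⟨S, hS, hsupp⟩ := ℓ.supp
  exact X.tendsto_term_zero_of_supp D p S (fun L hL => (hS L hL).1) xm h02 h13
    (X.linearIndependent_of_ballWedge hab) ℓ.level ℓ.loc hsupp o ho

end T4Data

end Summit.Ventures.HodgeRepro.Tier4.Line3

end
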